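import Literature.MathematicalPhysics.QuantumLattice.PairSourcedTorusLimitResponse
import Literature.MathematicalPhysics.QuantumLattice.InfVolFermionStateCompactness
import Literature.MathematicalPhysics.QuantumLattice.InfVolFermionStateMixture
import HarnessLib

/-!
# Torus TRIAL states of the pair-sourced `t–t'` Hubbard tori: their thermodynamic limits are
# translation-invariant states carrying the limiting density and sourced mean energy
# (the «tiled-trial-state TI bridge», steps (i)–(ii))

Topic `Literature/MathematicalPhysics/QuantumLattice`; namespace
`Literature.MathematicalPhysics.QuantumLattice` (the file path). Companion of
`PairSourcedTorusLimitResponse.lean` (torus limits of GROUND states of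
`A_L(h) = dWaveSourceTorusTT' L tp U μ h = H_L(1,tp,U) − μN − h(Δ_d + Δ_d†)`) for ARBITRARY unit torus
vectors — trial states. The tree's torus-limit predicate `InfVolFermionState.IsTorusLimitOf ω ψ Ls`
AVERAGES each torus vector state over the translation group of the torus before passing to the weak-⋆
limit (Bratteli–Robinson I §4.3.1), so the limit of ANY family of torus vectors is translation invariant
(`IsTorusLimitOf.isTranslationInvariant`); this file reads off its density and its sourced mean energy
from the two numbers per torus that a trial state carries — the particle number per site
`Re⟨ψ_L, N ψ_L⟩/L²` and the sourced energy per site `Re⟨ψ_L, A_L(h) ψ_L⟩/L²` — WITHOUT any fixed particle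
number (the pair source breaks `U(1)`; tiled products of parity-definite cluster vectors are not
`N`-eigenvectors, so the tree's `IsTorusLimitOf.density_eq`, which asks `IsNParticle`, does not apply).

* `torusAvgExpect_nAt_add_nAt_eq` — for EVERY vector `ψ` of the `d`-dimensional torus of side `L ≠ 0`,
  the translation average of the local density `n_{0↑} + n_{0↓}` is `⟨ψ, N ψ⟩/L^d`.
* `IsTorusLimitOf.density_eq_of_tendsto_expect_totalNumber` — hence a torus limit along `L_j → ∞` of
  vectors with `Re⟨ψ_{L_j}, N ψ_{L_j}⟩/L_j^d → ρ` has density `ρ` (any `d`).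
* `IsTorusLimitOf.meanEnergy_sourced_eq_of_tendsto` / `…_le_of_eventually_le` — the sourced mean energy
  `e^{src}_h(ω) = ω.meanEnergy (hubbardTTPrimeSourcedInteraction 1 tp U μ dWaveFormFactor h) 1` of a torus
  limit IS the limit of `Re⟨ψ_{L_j}, A_{L_j}(h) ψ_{L_j}⟩/L_j²` (tree:
  `IsTorusLimitOf.tendsto_re_expect_dWaveSourceTorusTT'`), so rows `Re⟨ψ_L, A_L(h) ψ_L⟩ ≤ u·L²` valid
  eventually give `e^{src}_h(ω) ≤ u`, and exact rows `= e·L²` give `e^{src}_h(ω) = e`.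
* `exists_isTranslationInvariant_density_eq_meanEnergy_sourced_eq_of_trialStates` (+ `_le_` form, + the
  per-side existential form `…_of_periodic_trialStates` for trial states available only on the tori of a
  sub-progression `q ∣ L`, `L ≥ L₀` — the tiling periods): unit torus vectors with EXACT per-site rows
  `Re⟨ψ_L, N ψ_L⟩ = n·L²`, `Re⟨ψ_L, A_L(h) ψ_L⟩ = e·L²` PRODUCE (weak-⋆ compactness,
  `InfVolFermionState.exists_isTorusLimitOf_subseq`) a translation-invariant state `σ` on `ℤ²` with
  `σ.density = n` and `e^{src}_h(σ) = e`. This is the infinite-volume reading of a TILED PRODUCT of a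
  parity-definite open-cluster vector `φ_C` over the `a × b` block partition of the `L`-torus
  (`a ∣ L`, `b ∣ L`): its per-site rows are `(⟨φ_C, N_C φ_C⟩/|C|, ⟨φ_C, A_C(h) φ_C⟩/|C|)` exactly (the
  torus identity is typed separately, `Summits/…/Rows/`), so each PURE tiled family yields a
  translation-invariant state of density = cluster filling per site and sourced energy = cluster Rayleigh
  quotient per site.
* `exists_isTranslationInvariant_density_eq_meanEnergy_sourced_le_of_two_trialStates` (+ periodic form):
  TWO such families with densities `n₁ < n₂` bracketing `n` and the literal side condition
  `(n₂ − n)·e₁ + (n − n₁)·e₂ ≤ u·(n₂ − n₁)` give a translation-invariant state of density EXACTLY `n` with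
  `e^{src}_h ≤ u` — by MIXING the two limits in infinite volume
  (`InfVolFermionState.exists_isTranslationInvariant_density_eq_meanEnergy_le'`,
  `InfVolFermionStateMixture.lean`). This is the hypothesis shape `hcap` of
  `Summits/Ventures/CertifiedManyBodySolver/Observables/TISourcedMinimiserChordFloor.lean` (the canonical
  TI-density class of the pinning-field chord floor, `μ = 0` pencil).

Everything is PROVED from the tree; no definition, no named fact, zero compute. HONEST SCOPE: a
variational CAP on a sourced mean energy in infinite volume from finite trial data; by itself it floors
nothing; the chord floors it feeds are finite-field RESPONSE floors, not order parameters.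

## References
* O. Bratteli, D. W. Robinson, *Operator Algebras and Quantum Statistical Mechanics 1* (1987), §4.3.1
  (invariant states as group averages; weak-⋆ limit points) and Thm. 2.3.15 (weak-⋆ compactness).
  [cite: BratteliRobinsonI1987, §4.3.1]
* D. Ruelle, *Statistical Mechanics* (1969), §3.4 (trial states and the mean energy per site).
  [cite: Ruelle1969, §3.4]
* T. Koma, H. Tasaki, J. Stat. Phys. 76 (1994) 745–803, §1 (symmetry-breaking source `H − hO`).
  [cite: KomaTasaki1994, §1]
* H. Tasaki, *Physics and Mathematics of Quantum Many-Body Systems* (2020), §2.1 (variational principle).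
  [cite: Tasaki2020, §2.1]
-/

noncomputable section

namespace Literature.MathematicalPhysics.QuantumLattice

open Matrix Finset HubbardWave0 _root_.Filter Literature.Probability.LatticeModels
open scoped _root_.Topology ComplexOrder

/-! ### §1 The number per site of an arbitrary torus vector and the density of its torus limits -/

section Density

variable {d : ℕ}

/-- The total number operator is the sum of the two spin-resolved number sums:
`N = Σ_y n_{y↑} + Σ_y n_{y↓}`. [folklore] -/
private theorem totalNumber_eq_sum_numberOp_add (L : ℕ) :
    (totalNumber : Matrix (Finset (Orb (FermionTorus d L))) (Finset (Orb (FermionTorus d L))) ℂ) =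
      (∑ y : FermionTorus d L, numberOp y 0) + ∑ y : FermionTorus d L, numberOp y 1 := by
  rw [totalNumber, ← Finset.sum_add_distrib]
  exact Finset.sum_congr rfl fun y _ => Fin.sum_univ_two _

/-- **The translation average of the local density is the number per site, for EVERY torus vector**:
`avg_L(n_{0↑})(ψ) + avg_L(n_{0↓})(ψ) = ⟨ψ, N ψ⟩ / L^d` (`L ≠ 0`; no particle-number hypothesis — the
translates of `n_{0σ}` exhaust `N_σ`, `torusAvgExpect_nAt`). [cite: BratteliRobinsonI1987, §4.3.1] -/
theorem torusAvgExpect_nAt_add_nAt_eq (L : ℕ) [NeZero L] (ψ : Fock (Orb (FermionTorus d L))) :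
    torusAvgExpect L ({0} : Finset (Site d)) (nAt 0 (Finset.mem_singleton_self 0) 0) ψ +
        torusAvgExpect L ({0} : Finset (Site d)) (nAt 0 (Finset.mem_singleton_self 0) 1) ψ =
      expect totalNumber ψ / ((L : ℂ) ^ d) := by
  rw [torusAvgExpect_nAt, torusAvgExpect_nAt, ← add_div, totalNumber_eq_sum_numberOp_add, expect, expect,
    expect, Matrix.add_mulVec, dotProduct_add]

variable {ω : InfVolFermionState d} {ψ : ∀ L, Fock (Orb (FermionTorus d L))} {Ls : ℕ → ℕ}

/-- **The density of a torus limit of arbitrary vectors is the limit of the numbers per site.** If `ω`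
is a torus limit of `ψ_L` along `L_j` (`L_j ≠ 0`) and `Re⟨ψ_{L_j}, N ψ_{L_j}⟩ / L_j^d → ρ`, then
`ω.density = ρ`. No `IsNParticle` hypothesis (cf. `IsTorusLimitOf.density_eq` for number eigenvectors).
[cite: Ruelle1969, §3.4] -/
theorem InfVolFermionState.IsTorusLimitOf.density_eq_of_tendsto_expect_totalNumber
    [hL0 : ∀ j, NeZero (Ls j)] (hω : ω.IsTorusLimitOf ψ Ls) {ρ : ℝ}
    (hρ : Tendsto (fun j => (QuantumLattice.expect totalNumber (ψ (Ls j))).re / (Ls j : ℝ) ^ d) atTop (𝓝 ρ)) :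
    ω.density = ρ := by
  have hN0 := hω ({0} : Finset (Site d)) (nAt 0 (Finset.mem_singleton_self 0) 0)
  have hN1 := hω ({0} : Finset (Site d)) (nAt 0 (Finset.mem_singleton_self 0) 1)
  have hre : ∀ {f : ℕ → ℂ} {a : ℂ}, Tendsto f atTop (𝓝 a) → Tendsto (fun j => (f j).re) atTop (𝓝 a.re) :=
    fun hf => (Complex.continuous_re.tendsto _).comp hf
  have hlim := hre (hN0.add hN1)
  have heq : ∀ j, (torusAvgExpect (Ls j) ({0} : Finset (Site d)) (nAt 0 (Finset.mem_singleton_self 0) 0) (ψ (Ls j)) +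
        torusAvgExpect (Ls j) ({0} : Finset (Site d)) (nAt 0 (Finset.mem_singleton_self 0) 1) (ψ (Ls j))).re =
      (QuantumLattice.expect totalNumber (ψ (Ls j))).re / (Ls j : ℝ) ^ d := by
    intro j
    have hLc : ((Ls j : ℂ)) ^ d = (((Ls j : ℝ) ^ d : ℝ) : ℂ) := by push_cast; rfl
    rw [torusAvgExpect_nAt_add_nAt_eq, hLc, Complex.div_ofReal_re]
  have hval : (ω.expect {0} (nAt 0 (Finset.mem_singleton_self 0) 0) +
      ω.expect {0} (nAt 0 (Finset.mem_singleton_self 0) 1)).re = ρ :=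
    tendsto_nhds_unique hlim (hρ.congr fun j => (heq j).symm)
  rw [InfVolFermionState.density, InfVolFermionState.densityAt, map_add]
  exact hval

/-- **Exact number rows**: if `Re⟨ψ_{L_j}, N ψ_{L_j}⟩ = n · L_j^d` for every `j`, the torus limit has
density `n`. [cite: Ruelle1969, §3.4] -/
theorem InfVolFermionState.IsTorusLimitOf.density_eq_of_expect_totalNumber_eq
    [hL0 : ∀ j, NeZero (Ls j)] (hω : ω.IsTorusLimitOf ψ Ls) {n : ℝ}
    (hn : ∀ j, (QuantumLattice.expect totalNumber (ψ (Ls j))).re = n * (Ls j : ℝ) ^ d) :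
    ω.density = n := by
  refine hω.density_eq_of_tendsto_expect_totalNumber (tendsto_const_nhds.congr fun j => ?_)
  have hL : (0 : ℝ) < (Ls j : ℝ) ^ d := pow_pos (Nat.cast_pos.2 (NeZero.pos (Ls j))) d
  rw [hn j, mul_div_assoc, div_self hL.ne', mul_one]

end Density

/-! ### §2 The sourced mean energy of a torus limit of trial vectors -/

section Energy

variable {ω : InfVolFermionState 2} {ψ : ∀ L, Fock (Orb (FermionTorus 2 L))} {Ls : ℕ → ℕ}

/-- **The sourced mean energy of a torus limit is the limit of the trial energies per site**: if
`Re⟨ψ_{L_j}, A_{L_j}(h) ψ_{L_j}⟩ / L_j² → e` then `e^{src}_h(ω) = e` (uniqueness of limits with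
`IsTorusLimitOf.tendsto_re_expect_dWaveSourceTorusTT'`). [cite: BratteliRobinsonI1987, §4.3.1] -/
theorem InfVolFermionState.IsTorusLimitOf.meanEnergy_sourced_eq_of_tendsto [hL0 : ∀ j, NeZero (Ls j)]
    (hω : ω.IsTorusLimitOf ψ Ls) (hLs : Tendsto Ls atTop atTop) (tp U μ h : ℝ) {e : ℝ}
    (he : Tendsto (fun j => (QuantumLattice.expect (dWaveSourceTorusTT' (Ls j) tp U μ h) (ψ (Ls j))).re /
      (Ls j : ℝ) ^ 2) atTop (𝓝 e)) :
    ω.meanEnergy (hubbardTTPrimeSourcedInteraction 1 tp U μ dWaveFormFactor h) 1 = e :=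
  tendsto_nhds_unique (hω.tendsto_re_expect_dWaveSourceTorusTT' hLs tp U μ h) he

/-- **Exact energy rows**: `Re⟨ψ_{L_j}, A_{L_j}(h) ψ_{L_j}⟩ = e · L_j²` for every `j` gives `e^{src}_h(ω) = e`.
[cite: BratteliRobinsonI1987, §4.3.1] -/
theorem InfVolFermionState.IsTorusLimitOf.meanEnergy_sourced_eq_of_expect_eq [hL0 : ∀ j, NeZero (Ls j)]
    (hω : ω.IsTorusLimitOf ψ Ls) (hLs : Tendsto Ls atTop atTop) (tp U μ h : ℝ) {e : ℝ}
    (he : ∀ j, (QuantumLattice.expect (dWaveSourceTorusTT' (Ls j) tp U μ h) (ψ (Ls j))).re = e * (Ls j : ℝ) ^ 2) :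
    ω.meanEnergy (hubbardTTPrimeSourcedInteraction 1 tp U μ dWaveFormFactor h) 1 = e := by
  refine hω.meanEnergy_sourced_eq_of_tendsto hLs tp U μ h (tendsto_const_nhds.congr fun j => ?_)
  have hL : (0 : ℝ) < (Ls j : ℝ) ^ 2 := pow_pos (Nat.cast_pos.2 (NeZero.pos (Ls j))) 2
  rw [he j, mul_div_assoc, div_self hL.ne', mul_one]

/-- **A trial CAP row bounds the sourced mean energy of the torus limit from above**: if
`Re⟨ψ_{L_j}, A_{L_j}(h) ψ_{L_j}⟩ ≤ u · L_j²` for all large `j`, then `e^{src}_h(ω) ≤ u` — for ARBITRARY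
vectors (no ground-state hypothesis; cf. `meanEnergy_sourced_le_of_groundState_of_groundEnergy_le`).
[cite: Ruelle1969, §3.4] -/
theorem InfVolFermionState.IsTorusLimitOf.meanEnergy_sourced_le_of_eventually_le [hL0 : ∀ j, NeZero (Ls j)]
    (hω : ω.IsTorusLimitOf ψ Ls) (hLs : Tendsto Ls atTop atTop) (tp U μ h : ℝ) {u : ℝ}
    (hu : ∀ᶠ j in atTop, (QuantumLattice.expect (dWaveSourceTorusTT' (Ls j) tp U μ h) (ψ (Ls j))).re ≤
      u * (Ls j : ℝ) ^ 2) :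
    ω.meanEnergy (hubbardTTPrimeSourcedInteraction 1 tp U μ dWaveFormFactor h) 1 ≤ u := by
  refine le_of_tendsto (hω.tendsto_re_expect_dWaveSourceTorusTT' hLs tp U μ h) ?_
  filter_upwards [hu] with j hj
  have hL : (0 : ℝ) < (Ls j : ℝ) ^ 2 := pow_pos (Nat.cast_pos.2 (NeZero.pos (Ls j))) 2
  rwa [div_le_iff₀ hL]

/-- **A trial FLOOR row** (e.g. the variational principle against a certified `E₀` floor) bounds it from
below: `lo · L_j² ≤ Re⟨ψ_{L_j}, A_{L_j}(h) ψ_{L_j}⟩` for all large `j` gives `lo ≤ e^{src}_h(ω)`.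
[cite: Ruelle1969, §3.4] -/
theorem InfVolFermionState.IsTorusLimitOf.le_meanEnergy_sourced_of_eventually_le [hL0 : ∀ j, NeZero (Ls j)]
    (hω : ω.IsTorusLimitOf ψ Ls) (hLs : Tendsto Ls atTop atTop) (tp U μ h : ℝ) {lo : ℝ}
    (hlo : ∀ᶠ j in atTop, lo * (Ls j : ℝ) ^ 2 ≤
      (QuantumLattice.expect (dWaveSourceTorusTT' (Ls j) tp U μ h) (ψ (Ls j))).re) :
    lo ≤ ω.meanEnergy (hubbardTTPrimeSourcedInteraction 1 tp U μ dWaveFormFactor h) 1 := by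
  refine ge_of_tendsto (hω.tendsto_re_expect_dWaveSourceTorusTT' hLs tp U μ h) ?_
  filter_upwards [hlo] with j hj
  have hL : (0 : ℝ) < (Ls j : ℝ) ^ 2 := pow_pos (Nat.cast_pos.2 (NeZero.pos (Ls j))) 2
  rwa [le_div_iff₀ hL]

end Energy

/-! ### §3 Trial families PRODUCE translation-invariant states with the prescribed density and sourced
mean energy -/

section Existence

/-- **One trial family, exact rows.** Unit torus vectors `ψ_L` along `L_j → ∞` (`L_j ≠ 0`) with exact
number rows `Re⟨ψ_{L_j}, N ψ_{L_j}⟩ = n·L_j²` and exact sourced-energy rows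
`Re⟨ψ_{L_j}, A_{L_j}(h) ψ_{L_j}⟩ = e·L_j²` (`A_L(h) = dWaveSourceTorusTT' L tp U μ h`) PRODUCE an
infinite-volume state `σ` on `ℤ²` — a torus limit of the family along a subsequence — that is
translation invariant, of density `n`, with `e^{src}_h(σ) = e`. (Tiled products of a parity-definite
cluster vector over the block partition of the `L`-tori have such rows with `n`, `e` the cluster number
and sourced Rayleigh quotient per site.) [cite: BratteliRobinsonI1987, §4.3.1] -/
theorem exists_isTranslationInvariant_density_eq_meanEnergy_sourced_eq_of_trialStates (tp U μ h : ℝ)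
    {Ls : ℕ → ℕ} [hL0 : ∀ j, NeZero (Ls j)] (hLs : Tendsto Ls atTop atTop)
    (ψ : ∀ L, Fock (Orb (FermionTorus 2 L))) (hψ1 : ∀ j, star (ψ (Ls j)) ⬝ᵥ ψ (Ls j) = 1) {n e : ℝ}
    (hn : ∀ j, (expect totalNumber (ψ (Ls j))).re = n * (Ls j : ℝ) ^ 2)
    (he : ∀ j, (expect (dWaveSourceTorusTT' (Ls j) tp U μ h) (ψ (Ls j))).re = e * (Ls j : ℝ) ^ 2) :
    ∃ σ : InfVolFermionState 2, (∃ φ : ℕ → ℕ, StrictMono φ ∧ σ.IsTorusLimitOf ψ (Ls ∘ φ)) ∧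
      σ.IsTranslationInvariant ∧ σ.density = n ∧
      σ.meanEnergy (hubbardTTPrimeSourcedInteraction 1 tp U μ dWaveFormFactor h) 1 = e := by
  obtain ⟨φ, hφ, σ, hσ⟩ := InfVolFermionState.exists_isTorusLimitOf_subseq ψ hLs hψ1
  have hLφ : Tendsto (fun j => Ls (φ j)) atTop atTop := hLs.comp hφ.tendsto_atTop
  have hσ' : σ.IsTorusLimitOf ψ (fun j => Ls (φ j)) := hσ
  exact ⟨σ, ⟨φ, hφ, hσ⟩, hσ.isTranslationInvariant,
    hσ'.density_eq_of_expect_totalNumber_eq fun j => hn (φ j),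
    hσ'.meanEnergy_sourced_eq_of_expect_eq hLφ tp U μ h fun j => he (φ j)⟩

/-- **One trial family, limiting rows.** Unit torus vectors along `L_j → ∞` with number per site
`→ n` and sourced energy per site eventually `≤ u·L_j²` produce a translation-invariant state of density
`n` with `e^{src}_h ≤ u`. [cite: Ruelle1969, §3.4] -/
theorem exists_isTranslationInvariant_density_eq_meanEnergy_sourced_le_of_trialStates (tp U μ h : ℝ)
    {Ls : ℕ → ℕ} [hL0 : ∀ j, NeZero (Ls j)] (hLs : Tendsto Ls atTop atTop)
    (ψ : ∀ L, Fock (Orb (FermionTorus 2 L))) (hψ1 : ∀ j, star (ψ (Ls j)) ⬝ᵥ ψ (Ls j) = 1) {n u : ℝ}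
    (hn : Tendsto (fun j => (expect totalNumber (ψ (Ls j))).re / (Ls j : ℝ) ^ 2) atTop (𝓝 n))
    (hu : ∀ᶠ j in atTop, (expect (dWaveSourceTorusTT' (Ls j) tp U μ h) (ψ (Ls j))).re ≤ u * (Ls j : ℝ) ^ 2) :
    ∃ σ : InfVolFermionState 2, (∃ φ : ℕ → ℕ, StrictMono φ ∧ σ.IsTorusLimitOf ψ (Ls ∘ φ)) ∧
      σ.IsTranslationInvariant ∧ σ.density = n ∧
      σ.meanEnergy (hubbardTTPrimeSourcedInteraction 1 tp U μ dWaveFormFactor h) 1 ≤ u := by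
  obtain ⟨φ, hφ, σ, hσ⟩ := InfVolFermionState.exists_isTorusLimitOf_subseq ψ hLs hψ1
  have hLφ : Tendsto (fun j => Ls (φ j)) atTop atTop := hLs.comp hφ.tendsto_atTop
  have hσ' : σ.IsTorusLimitOf ψ (fun j => Ls (φ j)) := hσ
  exact ⟨σ, ⟨φ, hφ, hσ⟩, hσ.isTranslationInvariant,
    hσ'.density_eq_of_tendsto_expect_totalNumber (hn.comp hφ.tendsto_atTop),
    hσ'.meanEnergy_sourced_le_of_eventually_le hLφ tp U μ h (hφ.tendsto_atTop.eventually hu)⟩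

/-- **Two trial families bracketing the density, and the mixture** (the `hcap` shape of the canonical
TI-density class). Unit torus vectors `ψ₁` along `L¹_j → ∞` with exact rows `(n₁, e₁)` and `ψ₂` along
`L²_j → ∞` with exact rows `(n₂, e₂)`, densities `n₁ < n₂` bracketing `n`, and the literal side condition
`(n₂ − n)·e₁ + (n − n₁)·e₂ ≤ u·(n₂ − n₁)`: SOME translation-invariant state of density EXACTLY `n` has
`e^{src}_h ≤ u` (mix the two torus limits with weight `(n₂ − n)/(n₂ − n₁)`; density and mean energy are
affine, `InfVolFermionStateMixture.lean`). [cite: BratteliRobinsonI1987, §4.3.1] -/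
theorem exists_isTranslationInvariant_density_eq_meanEnergy_sourced_le_of_two_trialStates (tp U μ h : ℝ)
    {Ls₁ Ls₂ : ℕ → ℕ} [hL1 : ∀ j, NeZero (Ls₁ j)] [hL2 : ∀ j, NeZero (Ls₂ j)]
    (hLs₁ : Tendsto Ls₁ atTop atTop) (hLs₂ : Tendsto Ls₂ atTop atTop)
    (ψ₁ ψ₂ : ∀ L, Fock (Orb (FermionTorus 2 L)))
    (hψ₁ : ∀ j, star (ψ₁ (Ls₁ j)) ⬝ᵥ ψ₁ (Ls₁ j) = 1) (hψ₂ : ∀ j, star (ψ₂ (Ls₂ j)) ⬝ᵥ ψ₂ (Ls₂ j) = 1)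
    {n₁ n₂ n e₁ e₂ u : ℝ}
    (hn₁ : ∀ j, (expect totalNumber (ψ₁ (Ls₁ j))).re = n₁ * (Ls₁ j : ℝ) ^ 2)
    (he₁ : ∀ j, (expect (dWaveSourceTorusTT' (Ls₁ j) tp U μ h) (ψ₁ (Ls₁ j))).re = e₁ * (Ls₁ j : ℝ) ^ 2)
    (hn₂ : ∀ j, (expect totalNumber (ψ₂ (Ls₂ j))).re = n₂ * (Ls₂ j : ℝ) ^ 2)
    (he₂ : ∀ j, (expect (dWaveSourceTorusTT' (Ls₂ j) tp U μ h) (ψ₂ (Ls₂ j))).re = e₂ * (Ls₂ j : ℝ) ^ 2)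
    (hlt : n₁ < n₂) (hle₁ : n₁ ≤ n) (hle₂ : n ≤ n₂) (hu : (n₂ - n) * e₁ + (n - n₁) * e₂ ≤ u * (n₂ - n₁)) :
    ∃ σ : InfVolFermionState 2, σ.IsTranslationInvariant ∧ σ.density = n ∧
      σ.meanEnergy (hubbardTTPrimeSourcedInteraction 1 tp U μ dWaveFormFactor h) 1 ≤ u := by
  obtain ⟨ω₁, -, hω₁, hρ₁, hE₁⟩ :=
    exists_isTranslationInvariant_density_eq_meanEnergy_sourced_eq_of_trialStates tp U μ h hLs₁ ψ₁ hψ₁ hn₁ he₁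
  obtain ⟨ω₂, -, hω₂, hρ₂, hE₂⟩ :=
    exists_isTranslationInvariant_density_eq_meanEnergy_sourced_eq_of_trialStates tp U μ h hLs₂ ψ₂ hψ₂ hn₂ he₂
  exact InfVolFermionState.exists_isTranslationInvariant_density_eq_meanEnergy_le' hω₁ hω₂ hρ₁ hρ₂ hlt hle₁ hle₂
    _ 1 hE₁.le hE₂.le hu

end Existence

/-! ### §4 Trial states on the tori of a sub-progression (the tiling periods) -/

section Periodic

/-- The sides `q·(j + L₀ + 1)` are nonzero for `q ≠ 0`. [folklore] -/
private theorem neZero_mul_succ {q : ℕ} (hq : 0 < q) (L₀ j : ℕ) : NeZero (q * (j + L₀ + 1)) :=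
  ⟨Nat.mul_ne_zero hq.ne' (Nat.succ_ne_zero _)⟩

/-- The sides `q·(j + L₀ + 1)` diverge. [folklore] -/
private theorem tendsto_mul_succ {q : ℕ} (hq : 0 < q) (L₀ : ℕ) :
    Tendsto (fun j : ℕ => q * (j + L₀ + 1)) atTop atTop := by
  refine tendsto_atTop_mono (fun j => ?_) tendsto_id
  calc id j = j := rfl
    _ ≤ j + L₀ + 1 := by omega
    _ = 1 * (j + L₀ + 1) := (one_mul _).symm
    _ ≤ q * (j + L₀ + 1) := Nat.mul_le_mul_right _ hq

/-- **Per-side existential form on a sub-progression.** Suppose that for every side `L` with `q ∣ L`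
and `L ≥ L₀` (`q ≥ 1`: the tiling period) there is a unit vector of the `L`-torus with exact rows
`Re⟨ψ, N ψ⟩ = n·L²` and `Re⟨ψ, A_L(h) ψ⟩ = e·L²`. Then there is a translation-invariant state `σ` on `ℤ²`
of density `n` with `e^{src}_h(σ) = e`. [cite: BratteliRobinsonI1987, §4.3.1] -/
theorem exists_isTranslationInvariant_density_eq_meanEnergy_sourced_eq_of_periodic_trialStates
    (tp U μ h : ℝ) {q : ℕ} (hq : 0 < q) (L₀ : ℕ) {n e : ℝ}
    (hrows : ∀ L : ℕ, q ∣ L → L₀ ≤ L → ∀ [NeZero L], ∃ ψ : Fock (Orb (FermionTorus 2 L)),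
      star ψ ⬝ᵥ ψ = 1 ∧ (expect totalNumber ψ).re = n * (L : ℝ) ^ 2 ∧
        (expect (dWaveSourceTorusTT' L tp U μ h) ψ).re = e * (L : ℝ) ^ 2) :
    ∃ σ : InfVolFermionState 2, σ.IsTranslationInvariant ∧ σ.density = n ∧
      σ.meanEnergy (hubbardTTPrimeSourcedInteraction 1 tp U μ dWaveFormFactor h) 1 = e := by
  classical
  -- a unit vector with the rows on every admissible torus (junk `0` elsewhere)
  have hex : ∀ L : ℕ, ∃ ψ : Fock (Orb (FermionTorus 2 L)), ∀ (hqL : q ∣ L) (hL : L₀ ≤ L) (hL0 : L ≠ 0),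
      star ψ ⬝ᵥ ψ = 1 ∧ (expect totalNumber ψ).re = n * (L : ℝ) ^ 2 ∧
        (expect (@dWaveSourceTorusTT' L ⟨hL0⟩ tp U μ h) ψ).re = e * (L : ℝ) ^ 2 := by
    intro L
    by_cases hc : q ∣ L ∧ L₀ ≤ L ∧ L ≠ 0
    · obtain ⟨ψ, hψ⟩ := @hrows L hc.1 hc.2.1 ⟨hc.2.2⟩
      exact ⟨ψ, fun _ _ _ => hψ⟩
    · refine ⟨0, fun hqL hL hL0 => absurd ⟨hqL, hL, hL0⟩ hc⟩
  choose ψ hψ using hex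
  set Ls : ℕ → ℕ := fun j => q * (j + L₀ + 1) with hLs_def
  haveI hL0 : ∀ j, NeZero (Ls j) := fun j => neZero_mul_succ hq L₀ j
  have hadm : ∀ j, q ∣ Ls j ∧ L₀ ≤ Ls j := fun j =>
    ⟨Dvd.intro _ rfl, by
      calc L₀ ≤ j + L₀ + 1 := by omega
        _ = 1 * (j + L₀ + 1) := (one_mul _).symm
        _ ≤ q * (j + L₀ + 1) := Nat.mul_le_mul_right _ hq⟩
  have hrow : ∀ j, star (ψ (Ls j)) ⬝ᵥ ψ (Ls j) = 1 ∧ (expect totalNumber (ψ (Ls j))).re = n * (Ls j : ℝ) ^ 2 ∧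
      (expect (dWaveSourceTorusTT' (Ls j) tp U μ h) (ψ (Ls j))).re = e * (Ls j : ℝ) ^ 2 :=
    fun j => hψ (Ls j) (hadm j).1 (hadm j).2 (hL0 j).ne
  obtain ⟨σ, -, hσ, hρ, hE⟩ :=
    exists_isTranslationInvariant_density_eq_meanEnergy_sourced_eq_of_trialStates tp U μ h (tendsto_mul_succ hq L₀)
      ψ (fun j => (hrow j).1) (fun j => (hrow j).2.1) (fun j => (hrow j).2.2)
  exact ⟨σ, hσ, hρ, hE⟩

/-- **Per-side CAP form on a sub-progression**: rows `Re⟨ψ, N ψ⟩ = n·L²` and `Re⟨ψ, A_L(h) ψ⟩ ≤ u·L²` on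
every admissible torus give a translation-invariant state of density `n` with `e^{src}_h ≤ u`.
[cite: Ruelle1969, §3.4] -/
theorem exists_isTranslationInvariant_density_eq_meanEnergy_sourced_le_of_periodic_trialStates
    (tp U μ h : ℝ) {q : ℕ} (hq : 0 < q) (L₀ : ℕ) {n u : ℝ}
    (hrows : ∀ L : ℕ, q ∣ L → L₀ ≤ L → ∀ [NeZero L], ∃ ψ : Fock (Orb (FermionTorus 2 L)),
      star ψ ⬝ᵥ ψ = 1 ∧ (expect totalNumber ψ).re = n * (L : ℝ) ^ 2 ∧
        (expect (dWaveSourceTorusTT' L tp U μ h) ψ).re ≤ u * (L : ℝ) ^ 2) :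
    ∃ σ : InfVolFermionState 2, σ.IsTranslationInvariant ∧ σ.density = n ∧
      σ.meanEnergy (hubbardTTPrimeSourcedInteraction 1 tp U μ dWaveFormFactor h) 1 ≤ u := by
  classical
  have hex : ∀ L : ℕ, ∃ ψ : Fock (Orb (FermionTorus 2 L)), ∀ (hqL : q ∣ L) (hL : L₀ ≤ L) (hL0 : L ≠ 0),
      star ψ ⬝ᵥ ψ = 1 ∧ (expect totalNumber ψ).re = n * (L : ℝ) ^ 2 ∧
        (expect (@dWaveSourceTorusTT' L ⟨hL0⟩ tp U μ h) ψ).re ≤ u * (L : ℝ) ^ 2 := by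
    intro L
    by_cases hc : q ∣ L ∧ L₀ ≤ L ∧ L ≠ 0
    · obtain ⟨ψ, hψ⟩ := @hrows L hc.1 hc.2.1 ⟨hc.2.2⟩
      exact ⟨ψ, fun _ _ _ => hψ⟩
    · refine ⟨0, fun hqL hL hL0 => absurd ⟨hqL, hL, hL0⟩ hc⟩
  choose ψ hψ using hex
  set Ls : ℕ → ℕ := fun j => q * (j + L₀ + 1) with hLs_def
  haveI hL0 : ∀ j, NeZero (Ls j) := fun j => neZero_mul_succ hq L₀ j
  have hadm : ∀ j, q ∣ Ls j ∧ L₀ ≤ Ls j := fun j =>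
    ⟨Dvd.intro _ rfl, by
      calc L₀ ≤ j + L₀ + 1 := by omega
        _ = 1 * (j + L₀ + 1) := (one_mul _).symm
        _ ≤ q * (j + L₀ + 1) := Nat.mul_le_mul_right _ hq⟩
  have hrow : ∀ j, star (ψ (Ls j)) ⬝ᵥ ψ (Ls j) = 1 ∧ (expect totalNumber (ψ (Ls j))).re = n * (Ls j : ℝ) ^ 2 ∧
      (expect (dWaveSourceTorusTT' (Ls j) tp U μ h) (ψ (Ls j))).re ≤ u * (Ls j : ℝ) ^ 2 :=
    fun j => hψ (Ls j) (hadm j).1 (hadm j).2 (hL0 j).ne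
  have hn : Tendsto (fun j => (expect totalNumber (ψ (Ls j))).re / (Ls j : ℝ) ^ 2) atTop (𝓝 n) := by
    refine tendsto_const_nhds.congr fun j => ?_
    have hL : (0 : ℝ) < (Ls j : ℝ) ^ 2 := pow_pos (Nat.cast_pos.2 (NeZero.pos (Ls j))) 2
    rw [(hrow j).2.1, mul_div_assoc, div_self hL.ne', mul_one]
  obtain ⟨σ, -, hσ, hρ, hE⟩ :=
    exists_isTranslationInvariant_density_eq_meanEnergy_sourced_le_of_trialStates tp U μ h (tendsto_mul_succ hq L₀)
      ψ (fun j => (hrow j).1) hn (Eventually.of_forall fun j => (hrow j).2.2)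
  exact ⟨σ, hσ, hρ, hE⟩

/-- **Two periodic trial families and the mixture** — the `hcap` shape of
`TISourcedMinimiserChordFloor.lean` from finite data: for `i = 1, 2`, on every torus of side `L` with
`qᵢ ∣ L`, `L ≥ Lᵢ` a unit vector with exact rows `(nᵢ, eᵢ)`; densities `n₁ < n₂` bracketing `n`; literal
side condition `(n₂ − n)·e₁ + (n − n₁)·e₂ ≤ u·(n₂ − n₁)`. Then SOME translation-invariant state of density
EXACTLY `n` has `e^{src}_h ≤ u`. [cite: BratteliRobinsonI1987, §4.3.1] -/
theorem exists_isTranslationInvariant_density_eq_meanEnergy_sourced_le_of_two_periodic_trialStates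
    (tp U μ h : ℝ) {q₁ q₂ : ℕ} (hq₁ : 0 < q₁) (hq₂ : 0 < q₂) (L₁ L₂ : ℕ) {n₁ n₂ n e₁ e₂ u : ℝ}
    (hrows₁ : ∀ L : ℕ, q₁ ∣ L → L₁ ≤ L → ∀ [NeZero L], ∃ ψ : Fock (Orb (FermionTorus 2 L)),
      star ψ ⬝ᵥ ψ = 1 ∧ (expect totalNumber ψ).re = n₁ * (L : ℝ) ^ 2 ∧
        (expect (dWaveSourceTorusTT' L tp U μ h) ψ).re = e₁ * (L : ℝ) ^ 2)
    (hrows₂ : ∀ L : ℕ, q₂ ∣ L → L₂ ≤ L → ∀ [NeZero L], ∃ ψ : Fock (Orb (FermionTorus 2 L)),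
      star ψ ⬝ᵥ ψ = 1 ∧ (expect totalNumber ψ).re = n₂ * (L : ℝ) ^ 2 ∧
        (expect (dWaveSourceTorusTT' L tp U μ h) ψ).re = e₂ * (L : ℝ) ^ 2)
    (hlt : n₁ < n₂) (hle₁ : n₁ ≤ n) (hle₂ : n ≤ n₂) (hu : (n₂ - n) * e₁ + (n - n₁) * e₂ ≤ u * (n₂ - n₁)) :
    ∃ σ : InfVolFermionState 2, σ.IsTranslationInvariant ∧ σ.density = n ∧
      σ.meanEnergy (hubbardTTPrimeSourcedInteraction 1 tp U μ dWaveFormFactor h) 1 ≤ u := by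
  obtain ⟨ω₁, hω₁, hρ₁, hE₁⟩ :=
    exists_isTranslationInvariant_density_eq_meanEnergy_sourced_eq_of_periodic_trialStates tp U μ h hq₁ L₁ hrows₁
  obtain ⟨ω₂, hω₂, hρ₂, hE₂⟩ :=
    exists_isTranslationInvariant_density_eq_meanEnergy_sourced_eq_of_periodic_trialStates tp U μ h hq₂ L₂ hrows₂
  exact InfVolFermionState.exists_isTranslationInvariant_density_eq_meanEnergy_le' hω₁ hω₂ hρ₁ hρ₂ hlt hle₁ hle₂
    _ 1 hE₁.le hE₂.le hu

/-- **`tp = 0` form** (the tree's `dWaveSourceTorus`, pilot-1's anchor `(U, n, t′) = (8, 7/8, 0)`): two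
periodic trial families with exact rows for `dWaveSourceTorus L U μ h` bracketing `n` and the literal side
condition give the `hcap` of the canonical-class chord floor for
`hubbardTTPrimeSourcedInteraction 1 0 U μ dWaveFormFactor h`. [cite: BratteliRobinsonI1987, §4.3.1] -/
theorem exists_isTranslationInvariant_density_eq_meanEnergy_sourced_le_of_two_periodic_trialStates_tp_zero
    (U μ h : ℝ) {q₁ q₂ : ℕ} (hq₁ : 0 < q₁) (hq₂ : 0 < q₂) (L₁ L₂ : ℕ) {n₁ n₂ n e₁ e₂ u : ℝ}
    (hrows₁ : ∀ L : ℕ, q₁ ∣ L → L₁ ≤ L → ∀ [NeZero L], ∃ ψ : Fock (Orb (FermionTorus 2 L)),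
      star ψ ⬝ᵥ ψ = 1 ∧ (expect totalNumber ψ).re = n₁ * (L : ℝ) ^ 2 ∧
        (expect (dWaveSourceTorus L U μ h) ψ).re = e₁ * (L : ℝ) ^ 2)
    (hrows₂ : ∀ L : ℕ, q₂ ∣ L → L₂ ≤ L → ∀ [NeZero L], ∃ ψ : Fock (Orb (FermionTorus 2 L)),
      star ψ ⬝ᵥ ψ = 1 ∧ (expect totalNumber ψ).re = n₂ * (L : ℝ) ^ 2 ∧
        (expect (dWaveSourceTorus L U μ h) ψ).re = e₂ * (L : ℝ) ^ 2)
    (hlt : n₁ < n₂) (hle₁ : n₁ ≤ n) (hle₂ : n ≤ n₂) (hu : (n₂ - n) * e₁ + (n - n₁) * e₂ ≤ u * (n₂ - n₁)) :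
    ∃ σ : InfVolFermionState 2, σ.IsTranslationInvariant ∧ σ.density = n ∧
      σ.meanEnergy (hubbardTTPrimeSourcedInteraction 1 0 U μ dWaveFormFactor h) 1 ≤ u := by
  refine exists_isTranslationInvariant_density_eq_meanEnergy_sourced_le_of_two_periodic_trialStates 0 U μ h
    hq₁ hq₂ L₁ L₂ (fun L hqL hL _ => ?_) (fun L hqL hL _ => ?_) hlt hle₁ hle₂ hu
  · simpa only [dWaveSourceTorusTT'_zero_tp] using hrows₁ L hqL hL
  · simpa only [dWaveSourceTorusTT'_zero_tp] using hrows₂ L hqL hL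

end Periodic

/-! ### §5 (appended) CAP rows on the energies: certificate-shaped inequalities instead of exact values -/

section PeriodicCap

/-- **Two periodic trial families with energy CAP rows and the mixture.** As
`exists_isTranslationInvariant_density_eq_meanEnergy_sourced_le_of_two_periodic_trialStates`, but the
sourced-energy rows are inequalities `Re⟨ψ, A_L(h) ψ⟩ ≤ eᵢ·L²` (the shape a rounded certificate prints);
the number rows stay exact. Densities `n₁ < n₂` bracketing `n` and `(n₂ − n)·e₁ + (n − n₁)·e₂ ≤ u·(n₂ − n₁)`
give a translation-invariant state of density EXACTLY `n` with `e^{src}_h ≤ u`.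
[cite: BratteliRobinsonI1987, §4.3.1] -/
theorem exists_isTranslationInvariant_density_eq_meanEnergy_sourced_le_of_two_periodic_trialCaps
    (tp U μ h : ℝ) {q₁ q₂ : ℕ} (hq₁ : 0 < q₁) (hq₂ : 0 < q₂) (L₁ L₂ : ℕ) {n₁ n₂ n e₁ e₂ u : ℝ}
    (hrows₁ : ∀ L : ℕ, q₁ ∣ L → L₁ ≤ L → ∀ [NeZero L], ∃ ψ : Fock (Orb (FermionTorus 2 L)),
      star ψ ⬝ᵥ ψ = 1 ∧ (expect totalNumber ψ).re = n₁ * (L : ℝ) ^ 2 ∧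
        (expect (dWaveSourceTorusTT' L tp U μ h) ψ).re ≤ e₁ * (L : ℝ) ^ 2)
    (hrows₂ : ∀ L : ℕ, q₂ ∣ L → L₂ ≤ L → ∀ [NeZero L], ∃ ψ : Fock (Orb (FermionTorus 2 L)),
      star ψ ⬝ᵥ ψ = 1 ∧ (expect totalNumber ψ).re = n₂ * (L : ℝ) ^ 2 ∧
        (expect (dWaveSourceTorusTT' L tp U μ h) ψ).re ≤ e₂ * (L : ℝ) ^ 2)
    (hlt : n₁ < n₂) (hle₁ : n₁ ≤ n) (hle₂ : n ≤ n₂) (hu : (n₂ - n) * e₁ + (n - n₁) * e₂ ≤ u * (n₂ - n₁)) :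
    ∃ σ : InfVolFermionState 2, σ.IsTranslationInvariant ∧ σ.density = n ∧
      σ.meanEnergy (hubbardTTPrimeSourcedInteraction 1 tp U μ dWaveFormFactor h) 1 ≤ u := by
  obtain ⟨ω₁, hω₁, hρ₁, hE₁⟩ :=
    exists_isTranslationInvariant_density_eq_meanEnergy_sourced_le_of_periodic_trialStates tp U μ h hq₁ L₁ hrows₁
  obtain ⟨ω₂, hω₂, hρ₂, hE₂⟩ :=
    exists_isTranslationInvariant_density_eq_meanEnergy_sourced_le_of_periodic_trialStates tp U μ h hq₂ L₂ hrows₂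
  exact InfVolFermionState.exists_isTranslationInvariant_density_eq_meanEnergy_le' hω₁ hω₂ hρ₁ hρ₂ hlt hle₁ hle₂
    _ 1 hE₁ hE₂ hu

/-- **`tp = 0` form with energy CAP rows** (the tree's `dWaveSourceTorus`).
[cite: BratteliRobinsonI1987, §4.3.1] -/
theorem exists_isTranslationInvariant_density_eq_meanEnergy_sourced_le_of_two_periodic_trialCaps_tp_zero
    (U μ h : ℝ) {q₁ q₂ : ℕ} (hq₁ : 0 < q₁) (hq₂ : 0 < q₂) (L₁ L₂ : ℕ) {n₁ n₂ n e₁ e₂ u : ℝ}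
    (hrows₁ : ∀ L : ℕ, q₁ ∣ L → L₁ ≤ L → ∀ [NeZero L], ∃ ψ : Fock (Orb (FermionTorus 2 L)),
      star ψ ⬝ᵥ ψ = 1 ∧ (expect totalNumber ψ).re = n₁ * (L : ℝ) ^ 2 ∧
        (expect (dWaveSourceTorus L U μ h) ψ).re ≤ e₁ * (L : ℝ) ^ 2)
    (hrows₂ : ∀ L : ℕ, q₂ ∣ L → L₂ ≤ L → ∀ [NeZero L], ∃ ψ : Fock (Orb (FermionTorus 2 L)),
      star ψ ⬝ᵥ ψ = 1 ∧ (expect totalNumber ψ).re = n₂ * (L : ℝ) ^ 2 ∧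
        (expect (dWaveSourceTorus L U μ h) ψ).re ≤ e₂ * (L : ℝ) ^ 2)
    (hlt : n₁ < n₂) (hle₁ : n₁ ≤ n) (hle₂ : n ≤ n₂) (hu : (n₂ - n) * e₁ + (n - n₁) * e₂ ≤ u * (n₂ - n₁)) :
    ∃ σ : InfVolFermionState 2, σ.IsTranslationInvariant ∧ σ.density = n ∧
      σ.meanEnergy (hubbardTTPrimeSourcedInteraction 1 0 U μ dWaveFormFactor h) 1 ≤ u := by
  refine exists_isTranslationInvariant_density_eq_meanEnergy_sourced_le_of_two_periodic_trialCaps 0 U μ h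
    hq₁ hq₂ L₁ L₂ (fun L hqL hL _ => ?_) (fun L hqL hL _ => ?_) hlt hle₁ hle₂ hu
  · simpa only [dWaveSourceTorusTT'_zero_tp] using hrows₁ L hqL hL
  · simpa only [dWaveSourceTorusTT'_zero_tp] using hrows₂ L hqL hL

/-- **One periodic family, `tp = 0`, exact rows** (a PURE tiled family at the anchor): a
translation-invariant state with density `n` and `e^{src}_h = e` for
`hubbardTTPrimeSourcedInteraction 1 0 U μ dWaveFormFactor h`. [cite: BratteliRobinsonI1987, §4.3.1] -/
theorem exists_isTranslationInvariant_density_eq_meanEnergy_sourced_eq_of_periodic_trialStates_tp_zero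
    (U μ h : ℝ) {q : ℕ} (hq : 0 < q) (L₀ : ℕ) {n e : ℝ}
    (hrows : ∀ L : ℕ, q ∣ L → L₀ ≤ L → ∀ [NeZero L], ∃ ψ : Fock (Orb (FermionTorus 2 L)),
      star ψ ⬝ᵥ ψ = 1 ∧ (expect totalNumber ψ).re = n * (L : ℝ) ^ 2 ∧
        (expect (dWaveSourceTorus L U μ h) ψ).re = e * (L : ℝ) ^ 2) :
    ∃ σ : InfVolFermionState 2, σ.IsTranslationInvariant ∧ σ.density = n ∧
      σ.meanEnergy (hubbardTTPrimeSourcedInteraction 1 0 U μ dWaveFormFactor h) 1 = e := by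
  refine exists_isTranslationInvariant_density_eq_meanEnergy_sourced_eq_of_periodic_trialStates 0 U μ h hq L₀
    fun L hqL hL _ => ?_
  simpa only [dWaveSourceTorusTT'_zero_tp] using hrows L hqL hL

end PeriodicCap

end Literature.MathematicalPhysics.QuantumLattice

end
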